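import Summits.QuantumFields.YangMills.Theorems.BalabanUVNodesN15KingModelFullPropagatorGradRiemannWeighted
import Summits.QuantumFields.YangMills.Theorems.BalabanUVNodesN15KingModelFullPropagatorGradRate

/-!
# N15 (NE2⁺), King-model rung, part 18c: the WEIGHTED two-spacing rate of the GRADIENT of King's fluctuation propagator

Cell `pub-ymgap-dag-n15-d` (R134 acceleration DAG, node N15 = NE2, strategy s3 KING-MODEL RUNG), part 18c — part 11b's paired induction
(`fullProp_riemannRateW_unif`, the weighted row-uniform Riemann-sum two-spacing rate of `G`) run on n15-e's DIFFERENTIATED peels (part O-b′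
`fullPropD_peel_pair_abs_le`, part M′ `ksDSlice_rate_unif`):

* ★★ `fullPropD_riemannRateW_unif` — for odd `L ≥ 3`, `a > 0`, a mass cap `m₀²`, `0 ≤ γ < 1`: `∃ δ₁ C > 0 ∀ K, n ≥ 1 ∀ 0 ≤ δ′ ≤ δ₁ ∀ (cube 2L^e)
  ∀ 0 < m² ≤ m₀² ∀ μ x′`,
  `N′^{−(d+1)}·Σ_{y′} |∂^{η′}_μG^{η′}_{K+n}(x′, y′) − ∂^η_μG^η_K(x, y)|·e^{δ′|B(x) − B(y)|} ≤ C·(L^{−γ∕2})^K` (`x, y` under `x′, y′`; `∂^η_μ` the forward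
  lattice derivative in the run's own lattice units `N·[G(x + e_μ, y) − G(x, y)]`) — the (3.36)∕(H3)-type RATE letter of the gradient in the
  Riemann-sum norm, NO off-diagonal restriction.  Gain per level `L^{−1}e^{δ₁}(1 + X∕A) ≤ L^{−1∕2} ≤ L^{−γ∕2}` (`e^{δ₁} ≤ 10∕9`, `A ≥ 2X`, `L ≥ 3`).
HONEST SCOPE.  King's A = 0 scalar model on King-admissible tori, odd `L ≥ 3`; a Riemann-sum statement (n15-e's O-b′ is the pointwise OFF-diagonal
rate); count-neutral (`--supports`), not a discharge of N15, nothing in `YMDAG.*` touched.  FOR: Prop. 3.8 (3.71) line 2 for the DRESSED minimiser.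
References: C. King, Commun. Math. Phys. 103 (1986) 323–349, (2.13)–(2.17) p.653, (2.20) p.654, Prop. 3.8 (3.71) p.664, (4.41)–(4.43) p.675
(`King1986`); T. Bałaban, Commun. Math. Phys. 89 (1983) 571–597, Theorem (1.10) p.573 clause 2 (`Balaban1983RegularityDecay`).
-/

noncomputable section

namespace Summit.QuantumFields.YangMills.BalabanUVNodes.N15.KingModel

open Real Finset Matrix
open Literature.MathematicalPhysics.QuantumFieldTheory.Balaban1983to89 (Params)
open Literature.MathematicalPhysics.QuantumFieldTheory.Balaban1983to89.B4Sect5Proof (latticeConst latticeConst_nonneg)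
open Literature.MathematicalPhysics.QuantumFieldTheory.Balaban1983to89.B5Prop11Plancherel (Tor fine unitVec)
open Literature.MathematicalPhysics.QuantumFieldTheory.King1986 (aK aK_pos)
open Literature.MathematicalPhysics.QuantumFieldTheory.King1986.Torus (constrainedProp flatten blockOf tdistT torCongr site
  blockOf_flatten tdistT_nonneg tdistT_sumBound constrainedProp_deriv_decay_blocks_unif)
open Summit.QuantumFields.YangMills.BalabanUVNodes.N15KingModelRung.Curved (KSliceIdx ksM ksU ksDSlice ksDSlice' underPtN mul_tdistT_blockOf_le
  blockOf_underPtN fullPropD_peel_pair_abs_le underPtN_flatten fine_assoc ksDSlice_rate_unif)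

variable {d : ℕ}

/-- THE GAIN OF THE DIFFERENTIATED PEEL (real arithmetic): with `s² = L⁻¹`, `0 < s`, `s² ≤ 1∕3`, `s ≤ θ`, `E ≤ 10∕9`, `0 ≤ X`, `2X ≤ A`, `0 ≤ T`:
`L⁻¹·E·(A·T + X·T) ≤ A·(θ·T)`. [folklore] -/
theorem gradPeel_gain {Linv s θ E A X T : ℝ} (hs : 0 < s) (hsq : s ^ 2 = Linv) (hs3 : s ^ 2 ≤ 1 / 3) (hθ : s ≤ θ) (hE0 : 0 ≤ E)
    (hE : E ≤ 10 / 9) (hX : 0 ≤ X) (hA : 2 * X ≤ A) (hT : 0 ≤ T) :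
    Linv * E * (A * T + X * T) ≤ A * (θ * T) := by
  have hA0 : 0 ≤ A := by linarith
  have hs35 : s ≤ 3 / 5 := by nlinarith
  -- `s·E·(A + X) ≤ A`
  have h1 : E * (A + X) ≤ (10 / 9) * ((3 / 2) * A) := by nlinarith
  have h2 : s * (E * (A + X)) ≤ (3 / 5) * ((10 / 9) * ((3 / 2) * A)) :=
    mul_le_mul hs35 h1 (by positivity) (by norm_num)
  have h3 : s * (E * (A + X)) ≤ A := h2.trans (by linarith)
  rw [← hsq]
  calc s ^ 2 * E * (A * T + X * T) = s * (s * (E * (A + X))) * T := by ring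
    _ ≤ s * A * T := by
        exact mul_le_mul_of_nonneg_right (mul_le_mul_of_nonneg_left h3 hs.le) hT
    _ ≤ θ * A * T := mul_le_mul_of_nonneg_right (mul_le_mul_of_nonneg_right hθ hA0) hT
    _ = A * (θ * T) := by ring

section RateDW

variable (L : ℕ) [NeZero L]

/-- **THE WEIGHTED TWO-SPACING η-RATE OF THE GRADIENT OF KING'S FULL `A = 0` FLUCTUATION PROPAGATOR IN THE ROW-UNIFORM RIEMANN-SUM NORM**: for
odd `L ≥ 3`, `a > 0`, a mass cap `m₀² ≥ 0` and `0 ≤ γ < 1` there are `δ₁, C > 0` such that for EVERY weight rate `0 ≤ δ′ ≤ δ₁`, every `K, n ≥ 1`,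
cube `M_μ = 2L^e`, mass `0 < m² ≤ m₀²`, direction `μ` and fine point `x′` of the `(K+n)`-level run:
`N′^{−(d+1)}·Σ_{y′} |N′·(G^{η′}_{K+n}(x′ + e_μ, y′) − G^{η′}_{K+n}(x′, y′)) − N·(G^η_K(x + e_μ, y) − G^η_K(x, y))|·e^{δ′·|B(x) − B(y)|_M} ≤ C·(L^{−γ∕2})^K`
(`x, y` under `x′, y′`).  Part 11b's paired induction on the differentiated peels (module docstring). [cite: King1986, (2.13)–(2.17) p.653, (2.20) p.654, Prop. 3.8 (3.71) p.664 (second line), (4.41)–(4.43) p.675; Balaban1983RegularityDecay, Theorem (1.10) p.573] -/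
theorem fullPropD_riemannRateW_unif (hLodd : Odd L) (hL : 2 ≤ L) {a : ℝ} (ha : 0 < a) {m0sq : ℝ} (hm0 : 0 ≤ m0sq) {γ : ℝ}
    (hγ0 : 0 ≤ γ) (hγ1 : γ < 1) :
    ∃ δ₁ C : ℝ, 0 < δ₁ ∧ 0 < C ∧ ∀ (K : ℕ), 1 ≤ K → ∀ (δ' : ℝ), 0 ≤ δ' → δ' ≤ δ₁ → ∀ (n : ℕ), 1 ≤ n →
      ∀ (e : ℕ) (M : Fin (d + 1) → ℕ) [∀ μ, NeZero (M μ)], (∀ μ, M μ = 2 * L ^ e) →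
      ∀ (msq : ℝ), 0 < msq → msq ≤ m0sq →
      ∀ (μ : Fin (d + 1)) (x' : Tor (fine (L ^ n * L ^ K) M)),
        ((((L ^ n * L ^ K : ℕ) : ℝ)) ^ (d + 1))⁻¹ *
            ∑ y', |((L ^ n * L ^ K : ℕ) : ℝ) *
                  (constrainedProp (L ^ n * L ^ K) M (aK a L (K + n)) (((L ^ n * L ^ K : ℕ) : ℝ) ^ 2) msq
                      (x' + unitVec (fine (L ^ n * L ^ K) M) μ) y'
                    - constrainedProp (L ^ n * L ^ K) M (aK a L (K + n)) (((L ^ n * L ^ K : ℕ) : ℝ) ^ 2) msq x' y')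
                - ((L ^ K : ℕ) : ℝ) *
                  (constrainedProp (L ^ K) M (aK a L K) (((L ^ K : ℕ) : ℝ) ^ 2) msq
                      (underPtN L K n M x' + unitVec (fine (L ^ K) M) μ) (underPtN L K n M y')
                    - constrainedProp (L ^ K) M (aK a L K) (((L ^ K : ℕ) : ℝ) ^ 2) msq (underPtN L K n M x') (underPtN L K n M y'))|
              * Real.exp (δ' * tdistT M (blockOf (L ^ K) M (underPtN L K n M x')) (blockOf (L ^ K) M (underPtN L K n M y')))
          ≤ C * ((L : ℝ) ^ (-(γ / 2))) ^ K := by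
  have hL1 : 1 < L := by omega
  have hL3 : 3 ≤ L := three_le_of_odd hLodd hL
  have hL1' : (1 : ℝ) ≤ L := by exact_mod_cast hL1.le
  have hL3r : (3 : ℝ) ≤ L := by exact_mod_cast hL3
  have hL0 : (0 : ℝ) < L := by positivity
  set θ : ℝ := (L : ℝ) ^ (-(γ / 2)) with hθdef
  have hθ0 : 0 < θ := Real.rpow_pos_of_pos hL0 _
  -- `s = L^{−1∕2}`: `s ≤ θ`, `s² = L⁻¹ ≤ 1∕3`
  set s : ℝ := (L : ℝ) ^ (-(1 / 2 : ℝ)) with hsdef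
  have hs0 : 0 < s := Real.rpow_pos_of_pos hL0 _
  have hsθ : s ≤ θ := by
    rw [hθdef, hsdef]
    exact Real.rpow_le_rpow_of_exponent_le hL1' (by linarith)
  have hsq : s ^ 2 = (L : ℝ)⁻¹ := by
    rw [hsdef, ← Real.rpow_natCast, ← Real.rpow_mul hL0.le, ← Real.rpow_neg_one]
    norm_num
  have hs3 : s ^ 2 ≤ 1 / 3 := by
    rw [hsq, one_div]
    exact inv_anti₀ (by norm_num) hL3r
  have hθL : (L : ℝ)⁻¹ ≤ θ := by
    rw [hθdef, ← Real.rpow_neg_one]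
    exact Real.rpow_le_rpow_of_exponent_le hL1' (by linarith)
  obtain ⟨δW, CW, hδW, hCW, HW⟩ := fullPropD_riemannMassW_unif (d := d) L hLodd hL ha hm0
  obtain ⟨δb, cb, hδb, hcb, Hb⟩ := constrainedProp_deriv_decay_blocks_unif (d + 1) L (by omega) ⟨hLodd, hL1⟩ ha hm0
  obtain ⟨Cr, κ, hCr, hκ, Hr⟩ := ksDSlice_rate_unif (d := d) L hLodd hL ha hm0 hγ0 hγ1
  have hKb := latticeConst_nonneg (d + 1) (half_pos hδb).le
  have hKκ := latticeConst_nonneg (d + 1) (half_pos hκ).le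
  -- the weight window `δ₁ = min(min(1∕10, δ_W), min(δ_b∕2, κ∕2))` and the constant
  set δ₁ : ℝ := min (min (1 / 10) δW) (min (δb / 2) (κ / 2)) with hδ₁def
  have hδ₁ : 0 < δ₁ := lt_min (lt_min (by norm_num) hδW) (lt_min (half_pos hδb) (half_pos hκ))
  have hδ₁h : δ₁ ≤ 1 / 10 := (min_le_left _ _).trans (min_le_left _ _)
  have hδ₁W : δ₁ ≤ δW := (min_le_left _ _).trans (min_le_right _ _)
  have hδ₁b : δ₁ ≤ δb / 2 := (min_le_right _ _).trans (min_le_left _ _)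
  have hδ₁κ : δ₁ ≤ κ / 2 := (min_le_right _ _).trans (min_le_right _ _)
  set B₁ : ℝ := CW + (L : ℝ) ^ (d + 1) * cb * latticeConst (d + 1) (δb / 2) with hB₁def
  have hB₁ : 0 ≤ B₁ := by positivity
  set A : ℝ := B₁ * L + 2 * (Cr * latticeConst (d + 1) (κ / 2)) + 1 with hAdef
  have hA : 0 < A := by positivity
  -- numerical facts used in the step, proved once: `e^{δ₁} ≤ 10∕9`, `2X ≤ A`
  have he : Real.exp δ₁ ≤ 10 / 9 := by
    have e1 : Real.exp (1 / 10 : ℝ) ≤ 1 / (1 - 1 / 10) := Real.exp_bound_div_one_sub_of_interval (by norm_num) (by norm_num)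
    exact (Real.exp_le_exp.mpr hδ₁h).trans (e1.trans (by norm_num))
  have hXA : 2 * (Cr * latticeConst (d + 1) (κ / 2)) ≤ A := by
    rw [hAdef]; linarith [mul_nonneg hB₁ hL0.le]
  refine ⟨δ₁, A, hδ₁, hA, ?_⟩
  intro K hK
  induction K, hK using Nat.le_induction with
  | base =>
    intro δ' hδ0 hδ1 n hn e M _ hM msq hmsq hcap μ x'
    set u := underPtN L 1 n M x' with hu
    have hNpos : (0 : ℝ) < (((L ^ n * L ^ 1 : ℕ) : ℝ)) ^ (d + 1) := by positivity
    -- the fine run: weighted gradient mass of an `(1+n)`-level propagator (part 18a); blocks of the points under = blocks of the points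
    have hfine' := HW (1 + n) (by omega) δ' hδ0 (hδ1.trans hδ₁W) (L ^ n * L ^ 1) (by rw [pow_add, mul_comm]) e M hM msq hmsq hcap μ x'
    have hfine : ((((L ^ n * L ^ 1 : ℕ) : ℝ)) ^ (d + 1))⁻¹ *
        ∑ y', |((L ^ n * L ^ 1 : ℕ) : ℝ) *
            (constrainedProp (L ^ n * L ^ 1) M (aK a L (1 + n)) (((L ^ n * L ^ 1 : ℕ) : ℝ) ^ 2) msq
                (x' + unitVec (fine (L ^ n * L ^ 1) M) μ) y'
              - constrainedProp (L ^ n * L ^ 1) M (aK a L (1 + n)) (((L ^ n * L ^ 1 : ℕ) : ℝ) ^ 2) msq x' y')|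
          * Real.exp (δ' * tdistT M (blockOf (L ^ 1) M u) (blockOf (L ^ 1) M (underPtN L 1 n M y'))) ≤ CW := by
      refine le_of_eq_of_le ?_ hfine'
      refine congrArg _ (sum_congr rfl fun y' _ => ?_)
      rw [hu, blockOf_underPtN L 1 n M x', blockOf_underPtN L 1 n M y']
    -- the coarse run: pointwise (1.10) clause 2 with the weight absorbed (`δ′ ≤ δ_b∕2`)
    set P : Params := ⟨d + 1, L, e, 1, by omega, ⟨hLodd, hL1⟩⟩ with hPdef
    have hMK : ∀ μ, M μ = P.sitesPerDir P.K := fun μ => by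
      rw [hM μ]
      simp [hPdef, Params.sitesPerDir]
    have hpt : ∀ y' : Tor (fine (L ^ n * L ^ 1) M),
        |((L ^ 1 : ℕ) : ℝ) * (constrainedProp (L ^ 1) M (aK a L 1) (((L ^ 1 : ℕ) : ℝ) ^ 2) msq (u + unitVec (fine (L ^ 1) M) μ)
              (underPtN L 1 n M y')
            - constrainedProp (L ^ 1) M (aK a L 1) (((L ^ 1 : ℕ) : ℝ) ^ 2) msq u (underPtN L 1 n M y'))
            * Real.exp (δ' * tdistT M (blockOf (L ^ 1) M u) (blockOf (L ^ 1) M (underPtN L 1 n M y')))|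
          ≤ (L : ℝ) ^ (d + 1) * cb * Real.exp (-(δb / 2 * tdistT M (blockOf (L ^ 1) M u) (blockOf (L ^ n * L ^ 1) M y'))) := by
      intro y'
      have h := Hb P rfl rfl le_rfl msq hmsq.le hcap M hMK (L ^ 1) rfl u (underPtN L 1 n M y') μ
      have hcast : (((L ^ 1 : ℕ) : ℝ)) ^ P.d * cb = (L : ℝ) ^ (d + 1) * cb := by simp [hPdef]
      rw [hcast, blockOf_underPtN L 1 n M y'] at h
      rw [blockOf_underPtN L 1 n M y']
      exact abs_mul_exp_le_of_decay (by positivity) (hδ1.trans hδ₁b) (tdistT_nonneg _ _ _) h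
    have hcoarse : ((((L ^ n * L ^ 1 : ℕ) : ℝ)) ^ (d + 1))⁻¹ *
          ∑ y', |((L ^ 1 : ℕ) : ℝ) * (constrainedProp (L ^ 1) M (aK a L 1) (((L ^ 1 : ℕ) : ℝ) ^ 2) msq (u + unitVec (fine (L ^ 1) M) μ)
                (underPtN L 1 n M y')
              - constrainedProp (L ^ 1) M (aK a L 1) (((L ^ 1 : ℕ) : ℝ) ^ 2) msq u (underPtN L 1 n M y'))
            * Real.exp (δ' * tdistT M (blockOf (L ^ 1) M u) (blockOf (L ^ 1) M (underPtN L 1 n M y')))|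
        ≤ (L : ℝ) ^ (d + 1) * cb * latticeConst (d + 1) (δb / 2) :=
      riemannSum_le_of_decay (L ^ n * L ^ 1) M (half_pos hδb) (by positivity) (blockOf (L ^ 1) M u) hpt
    have hθ1 : B₁ ≤ A * θ ^ 1 := by
      rw [pow_one]
      calc B₁ = B₁ * L * (L : ℝ)⁻¹ := by field_simp
        _ ≤ A * θ := mul_le_mul (by rw [hAdef]; linarith [mul_nonneg hCr.le hKκ]) hθL (inv_pos.mpr hL0).le hA.le
    -- termwise: `|a − b|·w ≤ |a|·w + |b·w|`
    have hsplit : ∀ y' : Tor (fine (L ^ n * L ^ 1) M),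
        |((L ^ n * L ^ 1 : ℕ) : ℝ) *
              (constrainedProp (L ^ n * L ^ 1) M (aK a L (1 + n)) (((L ^ n * L ^ 1 : ℕ) : ℝ) ^ 2) msq
                  (x' + unitVec (fine (L ^ n * L ^ 1) M) μ) y'
                - constrainedProp (L ^ n * L ^ 1) M (aK a L (1 + n)) (((L ^ n * L ^ 1 : ℕ) : ℝ) ^ 2) msq x' y')
            - ((L ^ 1 : ℕ) : ℝ) *
              (constrainedProp (L ^ 1) M (aK a L 1) (((L ^ 1 : ℕ) : ℝ) ^ 2) msq (u + unitVec (fine (L ^ 1) M) μ) (underPtN L 1 n M y')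
                - constrainedProp (L ^ 1) M (aK a L 1) (((L ^ 1 : ℕ) : ℝ) ^ 2) msq u (underPtN L 1 n M y'))|
            * Real.exp (δ' * tdistT M (blockOf (L ^ 1) M u) (blockOf (L ^ 1) M (underPtN L 1 n M y')))
          ≤ |((L ^ n * L ^ 1 : ℕ) : ℝ) *
                (constrainedProp (L ^ n * L ^ 1) M (aK a L (1 + n)) (((L ^ n * L ^ 1 : ℕ) : ℝ) ^ 2) msq
                    (x' + unitVec (fine (L ^ n * L ^ 1) M) μ) y'
                  - constrainedProp (L ^ n * L ^ 1) M (aK a L (1 + n)) (((L ^ n * L ^ 1 : ℕ) : ℝ) ^ 2) msq x' y')|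
              * Real.exp (δ' * tdistT M (blockOf (L ^ 1) M u) (blockOf (L ^ 1) M (underPtN L 1 n M y')))
            + |((L ^ 1 : ℕ) : ℝ) *
                (constrainedProp (L ^ 1) M (aK a L 1) (((L ^ 1 : ℕ) : ℝ) ^ 2) msq (u + unitVec (fine (L ^ 1) M) μ) (underPtN L 1 n M y')
                  - constrainedProp (L ^ 1) M (aK a L 1) (((L ^ 1 : ℕ) : ℝ) ^ 2) msq u (underPtN L 1 n M y'))
                * Real.exp (δ' * tdistT M (blockOf (L ^ 1) M u) (blockOf (L ^ 1) M (underPtN L 1 n M y')))| := by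
      intro y'
      have hw := Real.exp_pos (δ' * tdistT M (blockOf (L ^ 1) M u) (blockOf (L ^ 1) M (underPtN L 1 n M y')))
      rw [abs_mul (_ * _) (Real.exp _), abs_of_pos hw, ← add_mul]
      exact mul_le_mul_of_nonneg_right (abs_sub _ _) hw.le
    calc _ ≤ ((((L ^ n * L ^ 1 : ℕ) : ℝ)) ^ (d + 1))⁻¹ *
            ∑ y', (|((L ^ n * L ^ 1 : ℕ) : ℝ) *
                (constrainedProp (L ^ n * L ^ 1) M (aK a L (1 + n)) (((L ^ n * L ^ 1 : ℕ) : ℝ) ^ 2) msq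
                    (x' + unitVec (fine (L ^ n * L ^ 1) M) μ) y'
                  - constrainedProp (L ^ n * L ^ 1) M (aK a L (1 + n)) (((L ^ n * L ^ 1 : ℕ) : ℝ) ^ 2) msq x' y')|
                * Real.exp (δ' * tdistT M (blockOf (L ^ 1) M u) (blockOf (L ^ 1) M (underPtN L 1 n M y')))
              + |((L ^ 1 : ℕ) : ℝ) *
                (constrainedProp (L ^ 1) M (aK a L 1) (((L ^ 1 : ℕ) : ℝ) ^ 2) msq (u + unitVec (fine (L ^ 1) M) μ) (underPtN L 1 n M y')
                  - constrainedProp (L ^ 1) M (aK a L 1) (((L ^ 1 : ℕ) : ℝ) ^ 2) msq u (underPtN L 1 n M y'))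
                * Real.exp (δ' * tdistT M (blockOf (L ^ 1) M u) (blockOf (L ^ 1) M (underPtN L 1 n M y')))|) :=
          mul_le_mul_of_nonneg_left (sum_le_sum fun y' _ => hsplit y') (inv_nonneg.mpr hNpos.le)
      _ = ((((L ^ n * L ^ 1 : ℕ) : ℝ)) ^ (d + 1))⁻¹ *
              ∑ y', |((L ^ n * L ^ 1 : ℕ) : ℝ) *
                (constrainedProp (L ^ n * L ^ 1) M (aK a L (1 + n)) (((L ^ n * L ^ 1 : ℕ) : ℝ) ^ 2) msq
                    (x' + unitVec (fine (L ^ n * L ^ 1) M) μ) y'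
                  - constrainedProp (L ^ n * L ^ 1) M (aK a L (1 + n)) (((L ^ n * L ^ 1 : ℕ) : ℝ) ^ 2) msq x' y')|
                * Real.exp (δ' * tdistT M (blockOf (L ^ 1) M u) (blockOf (L ^ 1) M (underPtN L 1 n M y')))
            + ((((L ^ n * L ^ 1 : ℕ) : ℝ)) ^ (d + 1))⁻¹ *
              ∑ y', |((L ^ 1 : ℕ) : ℝ) *
                (constrainedProp (L ^ 1) M (aK a L 1) (((L ^ 1 : ℕ) : ℝ) ^ 2) msq (u + unitVec (fine (L ^ 1) M) μ) (underPtN L 1 n M y')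
                  - constrainedProp (L ^ 1) M (aK a L 1) (((L ^ 1 : ℕ) : ℝ) ^ 2) msq u (underPtN L 1 n M y'))
                * Real.exp (δ' * tdistT M (blockOf (L ^ 1) M u) (blockOf (L ^ 1) M (underPtN L 1 n M y')))| := by
          rw [sum_add_distrib, mul_add]
      _ ≤ CW + (L : ℝ) ^ (d + 1) * cb * latticeConst (d + 1) (δb / 2) := add_le_add hfine hcoarse
      _ ≤ A * θ ^ 1 := hθ1
  | succ K hK IH =>
    intro δ' hδ0 hδ1 n hn e M _ hM msq hmsq hcap μ x''
    obtain rfl : M = fun _ => 2 * L ^ e := funext hM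
    set i : KSliceIdx d := ⟨e, K, hK, n, hn, 0, Nat.zero_le e, 1, le_rfl⟩ with hidef
    have h : ∀ μ, fine (L ^ n * L ^ K * L) (ksM L i) μ = fine (L ^ n * L ^ (K + 1)) (ksM L i) μ :=
      fine_assoc L K n (ksM L i)
    set E := (flatten (L ^ n * L ^ K) L (ksM L i)).trans (torCongr h) with hEdef
    obtain ⟨x', rfl⟩ := E.surjective x''
    set x := underPtN L K n (ksU L i) x' with hxdef
    have hL2pos : (0 : ℝ) < (L : ℝ) ^ 2 := by positivity
    have hm2 : 0 < msq / (L : ℝ) ^ 2 := div_pos hmsq hL2pos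
    have hm2cap : msq / (L : ℝ) ^ 2 ≤ m0sq := by
      have h1 : (1 : ℝ) ≤ (L : ℝ) ^ 2 := one_le_pow₀ hL1'
      exact (div_le_self hmsq.le h1).trans hcap
    have hM' : ∀ μ, ksU L i μ = 2 * L ^ (e + 1) := fun μ => by
      show L * (2 * L ^ e) = 2 * L ^ (e + 1)
      ring
    -- the weight rate one level down and the weight under the peel (blocks of the points under)
    have hδL0 : 0 ≤ δ' / L := div_nonneg hδ0 hL0.le
    have hδL1 : δ' / L ≤ δ₁ := (div_le_self hδ0 hL1').trans hδ1
    have hδLκ : δ' / L ≤ κ / 2 := hδL1.trans hδ₁κ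
    set W : Tor (fine (L ^ n * L ^ K) (ksU L i)) → ℝ := fun y' =>
      Real.exp (δ' / L * tdistT (ksU L i) (blockOf (L ^ K) (ksU L i) x) (blockOf (L ^ K) (ksU L i) (underPtN L K n (ksU L i) y')))
      with hWdef
    have hW0 : ∀ y', 0 ≤ W y' := fun y' => (Real.exp_pos _).le
    have hwt : ∀ y' : Tor (fine (L ^ n * L ^ K) (ksU L i)),
        Real.exp (δ' * tdistT (fun _ : Fin (d + 1) => 2 * L ^ e)
          (blockOf (L ^ (K + 1)) (fun _ : Fin (d + 1) => 2 * L ^ e) (flatten (L ^ K) L (ksM L i) x))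
          (blockOf (L ^ (K + 1)) (fun _ : Fin (d + 1) => 2 * L ^ e) (flatten (L ^ K) L (ksM L i) (underPtN L K n (ksU L i) y'))))
        ≤ Real.exp δ₁ * W y' := by
      intro y'
      rw [hWdef, ← Real.exp_add]
      apply Real.exp_le_exp.mpr
      have hBx : blockOf (L ^ (K + 1)) (fun _ : Fin (d + 1) => 2 * L ^ e) (flatten (L ^ K) L (ksM L i) x)
          = blockOf L (ksM L i) (blockOf (L ^ K) (ksU L i) x) := blockOf_flatten (L ^ K) L (ksM L i) x
      have hBy : blockOf (L ^ (K + 1)) (fun _ : Fin (d + 1) => 2 * L ^ e) (flatten (L ^ K) L (ksM L i) (underPtN L K n (ksU L i) y'))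
          = blockOf L (ksM L i) (blockOf (L ^ K) (ksU L i) (underPtN L K n (ksU L i) y')) :=
        blockOf_flatten (L ^ K) L (ksM L i) (underPtN L K n (ksU L i) y')
      have hgrow : (L : ℝ) * tdistT (fun _ : Fin (d + 1) => 2 * L ^ e)
          (blockOf (L ^ (K + 1)) (fun _ : Fin (d + 1) => 2 * L ^ e) (flatten (L ^ K) L (ksM L i) x))
          (blockOf (L ^ (K + 1)) (fun _ : Fin (d + 1) => 2 * L ^ e) (flatten (L ^ K) L (ksM L i) (underPtN L K n (ksU L i) y')))
          ≤ tdistT (ksU L i) (blockOf (L ^ K) (ksU L i) x) (blockOf (L ^ K) (ksU L i) (underPtN L K n (ksU L i) y')) + ((L : ℝ) - 1) := by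
        rw [hBx, hBy]
        exact mul_tdistT_blockOf_le L (ksM L i) _ _
      have hw := weight_peel_le hL1' hδ0 hδ1 hgrow
      linarith
    -- abbreviations for the two differentiated kernels of the sub-pair and of the pair
    set D' : Tor (fine (L ^ n * L ^ K) (ksU L i)) → ℝ := fun y' =>
      ((L ^ n * L ^ K : ℕ) : ℝ) *
          (constrainedProp (L ^ n * L ^ K) (ksU L i) (aK a L (K + n)) (((L ^ n * L ^ K : ℕ) : ℝ) ^ 2) (msq / (L : ℝ) ^ 2)
              (x' + unitVec (fine (L ^ n * L ^ K) (ksU L i)) μ) y'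
            - constrainedProp (L ^ n * L ^ K) (ksU L i) (aK a L (K + n)) (((L ^ n * L ^ K : ℕ) : ℝ) ^ 2) (msq / (L : ℝ) ^ 2) x' y')
        - ((L ^ K : ℕ) : ℝ) *
          (constrainedProp (L ^ K) (ksU L i) (aK a L K) (((L ^ K : ℕ) : ℝ) ^ 2) (msq / (L : ℝ) ^ 2)
              (x + unitVec (fine (L ^ K) (ksU L i)) μ) (underPtN L K n (ksU L i) y')
            - constrainedProp (L ^ K) (ksU L i) (aK a L K) (((L ^ K : ℕ) : ℝ) ^ 2) (msq / (L : ℝ) ^ 2) x (underPtN L K n (ksU L i) y'))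
      with hD'def
    set DD : Tor (fine (L ^ n * L ^ K) (ksU L i)) → ℝ := fun y' =>
      ((L ^ n * L ^ (K + 1) : ℕ) : ℝ) *
          (constrainedProp (L ^ n * L ^ (K + 1)) (ksM L i) (aK a L (K + 1 + n)) (((L ^ n * L ^ (K + 1) : ℕ) : ℝ) ^ 2) msq
              (torCongr h (flatten (L ^ n * L ^ K) L (ksM L i) x') + unitVec (fine (L ^ n * L ^ (K + 1)) (ksM L i)) μ)
              (torCongr h (flatten (L ^ n * L ^ K) L (ksM L i) y'))
            - constrainedProp (L ^ n * L ^ (K + 1)) (ksM L i) (aK a L (K + 1 + n)) (((L ^ n * L ^ (K + 1) : ℕ) : ℝ) ^ 2) msq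
              (torCongr h (flatten (L ^ n * L ^ K) L (ksM L i) x')) (torCongr h (flatten (L ^ n * L ^ K) L (ksM L i) y')))
        - ((L ^ K * L : ℕ) : ℝ) *
          (constrainedProp (L ^ K * L) (ksM L i) (aK a L (K + 1)) (((L ^ K * L : ℕ) : ℝ) ^ 2) msq
              (flatten (L ^ K) L (ksM L i) x + unitVec (fine (L ^ K * L) (ksM L i)) μ) (flatten (L ^ K) L (ksM L i) (underPtN L K n (ksU L i) y'))
            - constrainedProp (L ^ K * L) (ksM L i) (aK a L (K + 1)) (((L ^ K * L : ℕ) : ℝ) ^ 2) msq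
              (flatten (L ^ K) L (ksM L i) x) (flatten (L ^ K) L (ksM L i) (underPtN L K n (ksU L i) y')))
      with hDDdef
    -- the induction hypothesis at the weight rate `δ′∕L` on the finer cube for the sub-pair
    have hIH : ((((L ^ n * L ^ K : ℕ) : ℝ)) ^ (d + 1))⁻¹ * ∑ y', |D' y'| * W y' ≤ A * θ ^ K :=
      IH (δ' / L) hδL0 hδL1 n hn (e + 1) (ksU L i) hM' (msq / (L : ℝ) ^ 2) hm2 hm2cap μ x'
    -- part M′'s differentiated-slice rate with the weight absorbed (`δ′∕L ≤ κ∕2`)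
    have hS : ((((L ^ n * L ^ K : ℕ) : ℝ)) ^ (d + 1))⁻¹ *
          ∑ y', |(ksDSlice' L a (msq / (L : ℝ) ^ 2) i μ x' y' - ksDSlice L a (msq / (L : ℝ) ^ 2) i μ x (underPtN L K n (ksU L i) y'))
            * W y'|
        ≤ Cr * θ ^ K * latticeConst (d + 1) (κ / 2) := by
      refine riemannSum_le_of_decay (L ^ n * L ^ K) (ksU L i) (half_pos hκ) (by positivity) (blockOf (L ^ K) (ksU L i) x) fun y' => ?_
      have h1 := Hr (msq / (L : ℝ) ^ 2) hm2 hm2cap i μ x' y'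
      have h2 := abs_mul_exp_le_of_decay (by positivity : 0 ≤ Cr * θ ^ K) hδLκ (tdistT_nonneg _ _ _) h1
      rw [blockOf_underPtN L K n (ksU L i) y'] at h2
      rw [hWdef]
      dsimp only
      rw [blockOf_underPtN L K n (ksU L i) y']
      exact h2
    have hNK : (0 : ℝ) < (((L ^ n * L ^ K : ℕ) : ℝ)) ^ (d + 1) := by positivity
    have hcast : (((L ^ n * L ^ (K + 1) : ℕ) : ℝ)) ^ (d + 1) = (L : ℝ) ^ (d + 1) * (((L ^ n * L ^ K : ℕ) : ℝ)) ^ (d + 1) := by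
      push_cast; ring
    have hsum : ∑ y'', |((L ^ n * L ^ (K + 1) : ℕ) : ℝ) *
              (constrainedProp (L ^ n * L ^ (K + 1)) (fun _ : Fin (d + 1) => 2 * L ^ e) (aK a L (K + 1 + n))
                  (((L ^ n * L ^ (K + 1) : ℕ) : ℝ) ^ 2) msq (E x' + unitVec (fine (L ^ n * L ^ (K + 1)) (fun _ : Fin (d + 1) => 2 * L ^ e)) μ) y''
                - constrainedProp (L ^ n * L ^ (K + 1)) (fun _ : Fin (d + 1) => 2 * L ^ e) (aK a L (K + 1 + n))
                  (((L ^ n * L ^ (K + 1) : ℕ) : ℝ) ^ 2) msq (E x') y'')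
            - ((L ^ (K + 1) : ℕ) : ℝ) *
              (constrainedProp (L ^ (K + 1)) (fun _ : Fin (d + 1) => 2 * L ^ e) (aK a L (K + 1)) (((L ^ (K + 1) : ℕ) : ℝ) ^ 2) msq
                  (underPtN L (K + 1) n (fun _ => 2 * L ^ e) (E x') + unitVec (fine (L ^ (K + 1)) (fun _ : Fin (d + 1) => 2 * L ^ e)) μ)
                  (underPtN L (K + 1) n (fun _ => 2 * L ^ e) y'')
                - constrainedProp (L ^ (K + 1)) (fun _ : Fin (d + 1) => 2 * L ^ e) (aK a L (K + 1)) (((L ^ (K + 1) : ℕ) : ℝ) ^ 2) msq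
                  (underPtN L (K + 1) n (fun _ => 2 * L ^ e) (E x')) (underPtN L (K + 1) n (fun _ => 2 * L ^ e) y''))|
          * Real.exp (δ' * tdistT (fun _ : Fin (d + 1) => 2 * L ^ e)
            (blockOf (L ^ (K + 1)) (fun _ : Fin (d + 1) => 2 * L ^ e) (underPtN L (K + 1) n (fun _ => 2 * L ^ e) (E x')))
            (blockOf (L ^ (K + 1)) (fun _ : Fin (d + 1) => 2 * L ^ e) (underPtN L (K + 1) n (fun _ => 2 * L ^ e) y'')))
        = ∑ y', |DD y'|
          * Real.exp (δ' * tdistT (fun _ : Fin (d + 1) => 2 * L ^ e)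
            (blockOf (L ^ (K + 1)) (fun _ : Fin (d + 1) => 2 * L ^ e) (flatten (L ^ K) L (ksM L i) x))
            (blockOf (L ^ (K + 1)) (fun _ : Fin (d + 1) => 2 * L ^ e) (flatten (L ^ K) L (ksM L i) (underPtN L K n (ksU L i) y')))) := by
      refine (Fintype.sum_equiv E _ _ fun y' => ?_).symm
      simp only [hDDdef, hEdef, Equiv.trans_apply]
      rw [underPtN_flatten L K n (ksM L i) h x', underPtN_flatten L K n (ksM L i) h y']
      rfl
    have hterm : ∀ y', |DD y'|
          * Real.exp (δ' * tdistT (fun _ : Fin (d + 1) => 2 * L ^ e)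
            (blockOf (L ^ (K + 1)) (fun _ : Fin (d + 1) => 2 * L ^ e) (flatten (L ^ K) L (ksM L i) x))
            (blockOf (L ^ (K + 1)) (fun _ : Fin (d + 1) => 2 * L ^ e) (flatten (L ^ K) L (ksM L i) (underPtN L K n (ksU L i) y'))))
        ≤ (L : ℝ) ^ (d + 1) / (L : ℝ) ^ 2 * L * Real.exp δ₁ *
          (|D' y'| * W y'
            + |(ksDSlice' L a (msq / (L : ℝ) ^ 2) i μ x' y' - ksDSlice L a (msq / (L : ℝ) ^ 2) i μ x (underPtN L K n (ksU L i) y'))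
                * W y'|) := by
      intro y'
      have hp : |DD y'| ≤ (L : ℝ) ^ (d + 1) / (L : ℝ) ^ 2 * L *
          (|D' y'| + |ksDSlice' L a (msq / (L : ℝ) ^ 2) i μ x' y' - ksDSlice L a (msq / (L : ℝ) ^ 2) i μ x (underPtN L K n (ksU L i) y')|) :=
        fullPropD_peel_pair_abs_le L hL ha hmsq i μ x' y' x (underPtN L K n (ksU L i) y') h
      have hSW : |(ksDSlice' L a (msq / (L : ℝ) ^ 2) i μ x' y' - ksDSlice L a (msq / (L : ℝ) ^ 2) i μ x (underPtN L K n (ksU L i) y'))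
            * W y'| = |ksDSlice' L a (msq / (L : ℝ) ^ 2) i μ x' y' - ksDSlice L a (msq / (L : ℝ) ^ 2) i μ x (underPtN L K n (ksU L i) y')|
              * W y' := by
        rw [abs_mul, abs_of_nonneg (hW0 y')]
      rw [hSW]
      calc _ ≤ (L : ℝ) ^ (d + 1) / (L : ℝ) ^ 2 * L *
            (|D' y'| + |ksDSlice' L a (msq / (L : ℝ) ^ 2) i μ x' y' - ksDSlice L a (msq / (L : ℝ) ^ 2) i μ x (underPtN L K n (ksU L i) y')|)
            * (Real.exp δ₁ * W y') := mul_le_mul hp (hwt y') (Real.exp_pos _).le (by positivity)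
        _ = _ := by ring
    -- the gain: `L^{−1}e^{δ₁}(Aθ^K + Xθ^K) ≤ Aθ^{K+1}`
    have hgain : (L : ℝ)⁻¹ * Real.exp δ₁ * (A * θ ^ K + Cr * θ ^ K * latticeConst (d + 1) (κ / 2)) ≤ A * θ ^ (K + 1) := by
      have hX := mul_nonneg hCr.le hKκ
      have e1 : Cr * θ ^ K * latticeConst (d + 1) (κ / 2) = (Cr * latticeConst (d + 1) (κ / 2)) * θ ^ K := by ring
      rw [e1, pow_succ, mul_comm (θ ^ K) θ]
      exact gradPeel_gain hs0 hsq hs3 hsθ (Real.exp_pos _).le he hX hXA (pow_nonneg hθ0.le K)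
    show ((((L ^ n * L ^ (K + 1) : ℕ) : ℝ)) ^ (d + 1))⁻¹ * ∑ y'', |((L ^ n * L ^ (K + 1) : ℕ) : ℝ) *
              (constrainedProp (L ^ n * L ^ (K + 1)) (fun _ : Fin (d + 1) => 2 * L ^ e) (aK a L (K + 1 + n))
                  (((L ^ n * L ^ (K + 1) : ℕ) : ℝ) ^ 2) msq (E x' + unitVec (fine (L ^ n * L ^ (K + 1)) (fun _ : Fin (d + 1) => 2 * L ^ e)) μ) y''
                - constrainedProp (L ^ n * L ^ (K + 1)) (fun _ : Fin (d + 1) => 2 * L ^ e) (aK a L (K + 1 + n))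
                  (((L ^ n * L ^ (K + 1) : ℕ) : ℝ) ^ 2) msq (E x') y'')
            - ((L ^ (K + 1) : ℕ) : ℝ) *
              (constrainedProp (L ^ (K + 1)) (fun _ : Fin (d + 1) => 2 * L ^ e) (aK a L (K + 1)) (((L ^ (K + 1) : ℕ) : ℝ) ^ 2) msq
                  (underPtN L (K + 1) n (fun _ => 2 * L ^ e) (E x') + unitVec (fine (L ^ (K + 1)) (fun _ : Fin (d + 1) => 2 * L ^ e)) μ)
                  (underPtN L (K + 1) n (fun _ => 2 * L ^ e) y'')
                - constrainedProp (L ^ (K + 1)) (fun _ : Fin (d + 1) => 2 * L ^ e) (aK a L (K + 1)) (((L ^ (K + 1) : ℕ) : ℝ) ^ 2) msq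
                  (underPtN L (K + 1) n (fun _ => 2 * L ^ e) (E x')) (underPtN L (K + 1) n (fun _ => 2 * L ^ e) y''))|
          * Real.exp (δ' * tdistT (fun _ : Fin (d + 1) => 2 * L ^ e)
            (blockOf (L ^ (K + 1)) (fun _ : Fin (d + 1) => 2 * L ^ e) (underPtN L (K + 1) n (fun _ => 2 * L ^ e) (E x')))
            (blockOf (L ^ (K + 1)) (fun _ : Fin (d + 1) => 2 * L ^ e) (underPtN L (K + 1) n (fun _ => 2 * L ^ e) y''))) ≤ A * θ ^ (K + 1)
    rw [hsum]
    calc ((((L ^ n * L ^ (K + 1) : ℕ) : ℝ)) ^ (d + 1))⁻¹ * ∑ y', |DD y'|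
            * Real.exp (δ' * tdistT (fun _ : Fin (d + 1) => 2 * L ^ e)
              (blockOf (L ^ (K + 1)) (fun _ : Fin (d + 1) => 2 * L ^ e) (flatten (L ^ K) L (ksM L i) x))
              (blockOf (L ^ (K + 1)) (fun _ : Fin (d + 1) => 2 * L ^ e) (flatten (L ^ K) L (ksM L i) (underPtN L K n (ksU L i) y'))))
        ≤ ((((L ^ n * L ^ (K + 1) : ℕ) : ℝ)) ^ (d + 1))⁻¹ * ∑ y', (L : ℝ) ^ (d + 1) / (L : ℝ) ^ 2 * L * Real.exp δ₁ *
            (|D' y'| * W y'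
              + |(ksDSlice' L a (msq / (L : ℝ) ^ 2) i μ x' y' - ksDSlice L a (msq / (L : ℝ) ^ 2) i μ x (underPtN L K n (ksU L i) y'))
                  * W y'|) :=
          mul_le_mul_of_nonneg_left (sum_le_sum fun y' _ => hterm y') (by positivity)
      _ = (L : ℝ)⁻¹ * Real.exp δ₁ *
            (((((L ^ n * L ^ K : ℕ) : ℝ)) ^ (d + 1))⁻¹ * ∑ y', |D' y'| * W y'
              + ((((L ^ n * L ^ K : ℕ) : ℝ)) ^ (d + 1))⁻¹ *
                ∑ y', |(ksDSlice' L a (msq / (L : ℝ) ^ 2) i μ x' y'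
                  - ksDSlice L a (msq / (L : ℝ) ^ 2) i μ x (underPtN L K n (ksU L i) y')) * W y'|) := by
          rw [hcast, ← mul_sum, sum_add_distrib]
          field_simp
          ring
      _ ≤ (L : ℝ)⁻¹ * Real.exp δ₁ * (A * θ ^ K + Cr * θ ^ K * latticeConst (d + 1) (κ / 2)) :=
          mul_le_mul_of_nonneg_left (add_le_add hIH hS) (by positivity)
      _ ≤ A * θ ^ (K + 1) := hgain

end RateDW

end Summit.QuantumFields.YangMills.BalabanUVNodes.N15.KingModel
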